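import Mathlib.LinearAlgebra.Lagrange
import Mathlib.Algebra.Polynomial.Div
import Mathlib.RingTheory.Polynomial.Basic
import Literature.Computability.AlgebraicComplexity.KaltofenFactorFromRoots
import HarnessLib

/-!
# Kaltofen's single-factor Hensel lifting: a COPRIME splitting of a polynomial with small
# circuits has small circuits — over EVERY field (engine; no separability)

Topic `Computability/AlgebraicComplexity`. Companion of `KaltofenFactorFromRoots.lean`
(`KaltofenFactor.complexity_le_of_rootData`: a SEPARABLE factor from its simple roots) and
`KaltofenFactorDescent.lean` (`KaltofenFactor.complexity_le_of_coprimeData`: a separable factor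
over a non-closed field). Both engines need the factor to be separable at the expansion point,
which fails for the factors `g^{p^e}` of Kaltofen's theorem in characteristic `p`
(Bläser–Ikenmeyer–Jindal–Lysikov 2018, Thm. 24; the tree's named fact `BIJL2018_thm24`). This
file proves the missing engine, which is Kaltofen's PRINTED route (Kaltofen 1986, §2, Algorithm
Factorization, Steps H "Hensel lifting loop" and L "lift by one degree": the `x`-adic
(homogeneous-degree) linear Hensel lifting of a coprime factorisation of `f(x, y)` from the fibre
`x = 0`, "lifting all minor variables simultaneously"):

* `KaltofenHensel.complexity_le_of_coprimeFactors` — let `G, P̂ ∈ F[x_β, y]`,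
  `optionEquivLeft G = P · Q` with `P, Q ∈ F[x][Y]` MONIC of degrees `a, b`,
  `optionEquivLeft P̂ = a₀ · P`, and suppose only that `P(0, Y)` and `Q(0, Y)` are COPRIME in
  `F[Y]` (no separability of `P(0, Y)`; `P = (g^{p^e})^j` is allowed). If `F` has `m = a + b`
  distinct elements `t_0, …, t_{m-1}` then for every `N ≥ deg P̂`
  `L(P̂) ≤ (N+2)² · (m · (2·N·m·(m·(L(G)+5)+1) + m·(m+1) + 2) + 2m + 2) + (N + 1)`.
  (`L = complexity`, fan-in-two circuit size with free constants.)

Honest framing: a 1986/1989 theorem of Kaltofen re-proved in Lean as an EXISTENCE statement about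
circuits (the randomised algorithm is not formalised); nothing here bears on `VP ≠ VNP`, which is
NOT proved.

## The argument (Kaltofen 1986 §2, Steps H/L, in the slow-Newton form)

Write `P₀ = P(0, Y)`, `Q₀ = Q(0, Y)` (constant terms of the `x`-coefficients), `ℓ_r` for the
Lagrange basis polynomials of the nodes `t_r` (`deg ℓ_r < m`). By Bézout (`IsCoprime P₀ Q₀`) and
division with remainder there are `M_r, N_r ∈ F[Y]` with `deg M_r < a`, `deg N_r < b` and
`M_r Q₀ + P₀ N_r = ℓ_r` (`exists_corrections`): the columns of the inverse of the Sylvester map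
`(μ, ν) ↦ μ Q₀ + P₀ ν` in the Lagrange basis. The LINEAR HENSEL ITERATION over `R = F[x]` is
`U_0 = P₀`, `W_0 = Q₀`,
`U_{k+1} = U_k + Σ_r E_k(t_r) · M_r`, `W_{k+1} = W_k + Σ_r E_k(t_r) · N_r`, `E_k = P Q - U_k W_k`
(ONE fixed `F`-linear map applied to the VALUES of the error at the nodes — no coefficient
extraction, so no characteristic hypothesis). INVARIANT (`iterate_invariant`): `P - U_k` has
degree `< a`, `Q - W_k` degree `< b`, and all their `x`-coefficients vanish to order `k + 1`
(`∈ ⟨x⟩^{k+1}`). Proof: with `δ = P - U_k`, `ε = Q - W_k` one has `E_k = δ W_k + P ε ≡ δ Q₀ + P₀ ε`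
modulo order `k + 2`, and `Σ_r (μ Q₀ + P₀ ν)(t_r) M_r = μ`, `Σ_r (μ Q₀ + P₀ ν)(t_r) N_r = ν` for
ALL `μ, ν ∈ R[Y]` of degrees `< a, < b` (`sylvester_inverse`: Lagrange interpolation over the
domain `R` and the injectivity of the Sylvester map, `eq_zero_of_sylvester`, from `IsCoprime`).
Hence `P ≡ U_N` to order `N + 1`, and `P̂` is the truncation at total degree `N` of
`a₀ · U_N(x, y)` (`KaltofenFactor.eq_sum_homogeneousComponent_of_coeff_vanish`). COST: the node
values `U_k(t_s), W_k(t_s) ∈ F[x]` evolve by ONE fixed polynomial map `Φ` in `2m` state variables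
whose coefficients involve the `m` specialisations `G(x, t_r)` (`L(Φ_j) ≤ m (L(G) + 5) + 1`); the
`k`-th iterate is obtained by substituting `Φ` into the `(k-1)`-st iterate viewed as a polynomial
in the state variables ("iterate as the OUTER function": `L` grows by `Σ_j L(Φ_j)` per step,
`complexity_aeval_le`), so `L(U_N(t_s)) ≤ N · 2m · (m (L(G)+5) + 1)`; `U_N(x, y)` is re-assembled
from its node values by Lagrange interpolation in `y` (`U_N - Y^a` has degree `< a ≤ m`), and one
truncation (BCS Lemma (21.25), `complexity_sum_homogeneousComponent_le`, valid over every
commutative semiring) finishes.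

No definitions, no named facts (theorem-only; the iteration and the step map enter the lemmas as
arbitrary functions with their defining equations as hypotheses).

## References

* [Kaltofen1986] E. Kaltofen, *Uniform closure properties of P-computable functions*, Proc. 18th
  STOC (1986) 330–337, §2 (Algorithm Factorization: Step H "Hensel lifting loop", Step L "lift
  by one degree"; p. 331: "employ Hensel lifting but … replace the p-adic expansion of the
  coefficients by the expansions into homogeneous parts of the minor variables"), Thm. 2.1.
* [Kaltofen1989] E. Kaltofen, *Factorization of polynomials given by straight-line programs*,
  in: Randomness and Computation, JAI Press 1989, 375–412 (journal version).
* [Kaltofen1987] E. Kaltofen, *Single-factor Hensel lifting and its application to the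
  straight-line complexity of certain polynomials*, Proc. 19th STOC (1987) 443–452.
* [BlaserIkenmeyerJindalLysikov2018] Thm. 24 (the consumer: Kaltofen's theorem over `𝔽_p`).
* [BurgisserClausenShokrollahi1997] Lemma (21.25) (homogeneous components).
-/

noncomputable section

namespace Literature.Computability.AlgebraicComplexity

open MvPolynomial Finset

namespace KaltofenHensel

/-! ### Vanishing order at the origin (toolkit, as in `KaltofenFactorFromRoots`) -/

section Vanish

variable {F : Type*} [Field F] {β : Type*}

/-- Vanishing to order `j` in terms of the support. [folklore] -/
private theorem vanish_iff {j : ℕ} {p : MvPolynomial β F} :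
    (∀ i < j, homogeneousComponent i p = 0) ↔ ∀ m ∈ p.support, j ≤ m.degree := by
  constructor
  · intro h m hm
    by_contra hlt
    push Not at hlt
    have hc := congrArg (coeff m) (h _ hlt)
    rw [coeff_homogeneousComponent, if_pos rfl, coeff_zero] at hc
    exact (mem_support_iff.1 hm) hc
  · intro h i hi
    exact homogeneousComponent_eq_zero' _ _ fun m hm => by have := h m hm; omega

/-- Vanishing orders add under multiplication. [folklore] -/
private theorem vanish_mul {i j : ℕ} {p q : MvPolynomial β F}
    (hp : ∀ k < i, homogeneousComponent k p = 0) (hq : ∀ k < j, homogeneousComponent k q = 0) :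
    ∀ k < i + j, homogeneousComponent k (p * q) = 0 := by
  classical
  rw [vanish_iff] at hp hq ⊢
  intro m hm
  open Pointwise in
  obtain ⟨m₁, hm₁, m₂, hm₂, rfl⟩ := Finset.mem_add.1 (support_mul p q hm)
  rw [map_add]
  exact add_le_add (hp _ hm₁) (hq _ hm₂)

/-- A right factor does not lower the vanishing order. [folklore] -/
private theorem vanish_mul_right {i : ℕ} {p : MvPolynomial β F}
    (hp : ∀ k < i, homogeneousComponent k p = 0) (q : MvPolynomial β F) :
    ∀ k < i, homogeneousComponent k (p * q) = 0 := by
  have hq : ∀ k < 0, homogeneousComponent k q = 0 := fun k hk => absurd hk (Nat.not_lt_zero k)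
  simpa using vanish_mul hp hq

/-- A left factor does not lower the vanishing order. [folklore] -/
private theorem vanish_mul_left {i : ℕ} (q : MvPolynomial β F) {p : MvPolynomial β F}
    (hp : ∀ k < i, homogeneousComponent k p = 0) :
    ∀ k < i, homogeneousComponent k (q * p) = 0 := by
  rw [mul_comm]; exact vanish_mul_right hp q

/-- Differences. [folklore] -/
private theorem vanish_sub {i : ℕ} {p q : MvPolynomial β F}
    (hp : ∀ k < i, homogeneousComponent k p = 0) (hq : ∀ k < i, homogeneousComponent k q = 0) :
    ∀ k < i, homogeneousComponent k (p - q) = 0 := fun k hk => by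
  rw [map_sub, hp k hk, hq k hk, sub_zero]

/-- Negation. [folklore] -/
private theorem vanish_neg {i : ℕ} {p : MvPolynomial β F}
    (hp : ∀ k < i, homogeneousComponent k p = 0) :
    ∀ k < i, homogeneousComponent k (-p) = 0 := fun k hk => by
  rw [map_neg, hp k hk, neg_zero]

/-- Finite sums. [folklore] -/
private theorem vanish_sum {i : ℕ} {ι : Type*} (s : Finset ι) {g : ι → MvPolynomial β F}
    (h : ∀ a ∈ s, ∀ k < i, homogeneousComponent k (g a) = 0) :
    ∀ k < i, homogeneousComponent k (∑ a ∈ s, g a) = 0 := fun k hk => by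
  rw [map_sum]
  exact Finset.sum_eq_zero fun a ha => h a ha k hk

/-- Weakening the order. [folklore] -/
private theorem vanish_mono {i j : ℕ} (hij : i ≤ j) {p : MvPolynomial β F}
    (hp : ∀ k < j, homogeneousComponent k p = 0) : ∀ k < i, homogeneousComponent k p = 0 :=
  fun k hk => hp k (lt_of_lt_of_le hk hij)

/-- `u - C (u(0))` vanishes to order `1`. [folklore] -/
private theorem vanish_sub_C_constantCoeff (u : MvPolynomial β F) :
    ∀ k < 1, homogeneousComponent k (u - C (constantCoeff u)) = 0 := by
  intro k hk
  obtain rfl : k = 0 := by omega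
  rw [homogeneousComponent_zero, coeff_sub, coeff_zero_C, ← constantCoeff_eq, sub_self, C_0]

end Vanish

/-! ### Coefficientwise vanishing order for `F[x][Y]` -/

section PolyVanish

variable {F : Type*} [Field F] {β : Type*}

/-- Products: if all coefficients of `Φ` vanish to order `i` and those of `Ψ` to order `j`, the
coefficients of `Φ Ψ` vanish to order `i + j`. [folklore] -/
private theorem pvanish_mul {i j : ℕ} {Φ Ψ : Polynomial (MvPolynomial β F)}
    (hΦ : ∀ n, ∀ k < i, homogeneousComponent k (Φ.coeff n) = 0)
    (hΨ : ∀ n, ∀ k < j, homogeneousComponent k (Ψ.coeff n) = 0) :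
    ∀ n, ∀ k < i + j, homogeneousComponent k ((Φ * Ψ).coeff n) = 0 := by
  intro n
  rw [Polynomial.coeff_mul]
  exact vanish_sum _ fun x _ => vanish_mul (hΦ x.1) (hΨ x.2)

/-- A right factor does not lower the coefficientwise vanishing order. [folklore] -/
private theorem pvanish_mul_right {i : ℕ} {Φ : Polynomial (MvPolynomial β F)}
    (hΦ : ∀ n, ∀ k < i, homogeneousComponent k (Φ.coeff n) = 0)
    (Ψ : Polynomial (MvPolynomial β F)) :
    ∀ n, ∀ k < i, homogeneousComponent k ((Φ * Ψ).coeff n) = 0 := by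
  have hΨ : ∀ n, ∀ k < 0, homogeneousComponent k (Ψ.coeff n) = 0 :=
    fun n k hk => absurd hk (Nat.not_lt_zero k)
  simpa using pvanish_mul hΦ hΨ

/-- A left factor does not lower the coefficientwise vanishing order. [folklore] -/
private theorem pvanish_mul_left {i : ℕ} (Ψ : Polynomial (MvPolynomial β F))
    {Φ : Polynomial (MvPolynomial β F)}
    (hΦ : ∀ n, ∀ k < i, homogeneousComponent k (Φ.coeff n) = 0) :
    ∀ n, ∀ k < i, homogeneousComponent k ((Ψ * Φ).coeff n) = 0 := by
  rw [mul_comm]; exact pvanish_mul_right hΦ Ψ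

/-- Sums. [folklore] -/
private theorem pvanish_add {i : ℕ} {Φ Ψ : Polynomial (MvPolynomial β F)}
    (hΦ : ∀ n, ∀ k < i, homogeneousComponent k (Φ.coeff n) = 0)
    (hΨ : ∀ n, ∀ k < i, homogeneousComponent k (Ψ.coeff n) = 0) :
    ∀ n, ∀ k < i, homogeneousComponent k ((Φ + Ψ).coeff n) = 0 := fun n k hk => by
  rw [Polynomial.coeff_add, map_add, hΦ n k hk, hΨ n k hk, add_zero]

/-- Differences. [folklore] -/
private theorem pvanish_sub {i : ℕ} {Φ Ψ : Polynomial (MvPolynomial β F)}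
    (hΦ : ∀ n, ∀ k < i, homogeneousComponent k (Φ.coeff n) = 0)
    (hΨ : ∀ n, ∀ k < i, homogeneousComponent k (Ψ.coeff n) = 0) :
    ∀ n, ∀ k < i, homogeneousComponent k ((Φ - Ψ).coeff n) = 0 := fun n k hk => by
  rw [Polynomial.coeff_sub, map_sub, hΦ n k hk, hΨ n k hk, sub_zero]

/-- Finite sums. [folklore] -/
private theorem pvanish_sum {i : ℕ} {ι : Type*} (s : Finset ι)
    {Φ : ι → Polynomial (MvPolynomial β F)}
    (h : ∀ a ∈ s, ∀ n, ∀ k < i, homogeneousComponent k ((Φ a).coeff n) = 0) :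
    ∀ n, ∀ k < i, homogeneousComponent k ((∑ a ∈ s, Φ a).coeff n) = 0 := fun n k hk => by
  rw [Polynomial.finsetSum_coeff, map_sum]
  exact Finset.sum_eq_zero fun a ha => h a ha n k hk

/-- Weakening. [folklore] -/
private theorem pvanish_mono {i j : ℕ} (hij : i ≤ j) {Φ : Polynomial (MvPolynomial β F)}
    (hΦ : ∀ n, ∀ k < j, homogeneousComponent k (Φ.coeff n) = 0) :
    ∀ n, ∀ k < i, homogeneousComponent k (Φ.coeff n) = 0 :=
  fun n => vanish_mono hij (hΦ n)

/-- Evaluation at a scalar node: if all coefficients of `Φ` vanish to order `i`, so does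
`Φ(C c)`. [folklore] -/
private theorem vanish_eval_C {i : ℕ} {Φ : Polynomial (MvPolynomial β F)}
    (hΦ : ∀ n, ∀ k < i, homogeneousComponent k (Φ.coeff n) = 0) (c : F) :
    ∀ k < i, homogeneousComponent k (Φ.eval (C c)) = 0 := by
  rw [Polynomial.eval_eq_sum_range]
  exact vanish_sum _ fun n _ => vanish_mul_right (hΦ n) _

/-- `C e · Ψ` with `e` vanishing to order `i` has all coefficients vanishing to order `i`.
[folklore] -/
private theorem pvanish_C_mul {i : ℕ} {e : MvPolynomial β F}
    (he : ∀ k < i, homogeneousComponent k e = 0) (Ψ : Polynomial (MvPolynomial β F)) :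
    ∀ n, ∀ k < i, homogeneousComponent k ((Polynomial.C e * Ψ).coeff n) = 0 := by
  intro n
  rw [Polynomial.coeff_C_mul]
  exact vanish_mul_right he _

/-- `Φ - Φ(0, Y)` (subtracting the constant terms of all coefficients) vanishes to order `1`.
[folklore] -/
private theorem pvanish_sub_map_constantCoeff (Φ : Polynomial (MvPolynomial β F)) :
    ∀ n, ∀ k < 1, homogeneousComponent k
      ((Φ - Φ.map ((C : F →+* MvPolynomial β F).comp constantCoeff)).coeff n) = 0 := by
  intro n
  rw [Polynomial.coeff_sub, Polynomial.coeff_map, RingHom.comp_apply]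
  exact vanish_sub_C_constantCoeff _

end PolyVanish

/-! ### Degrees -/

section Degrees

variable {R : Type*} [CommRing R]

/-- `deg (μ q) < a + b` when `deg μ < a` and `deg q ≤ b`. [folklore] -/
private theorem degree_mul_lt_left {μ q : Polynomial R} {a b : ℕ} (hμ : μ.degree < a)
    (hq : q.natDegree ≤ b) : (μ * q).degree < (a + b : ℕ) := by
  by_cases hμ0 : μ = 0
  · rw [hμ0, zero_mul, Polynomial.degree_zero]; exact WithBot.bot_lt_coe _
  refine (Polynomial.degree_mul_le _ _).trans_lt ?_
  rw [Polynomial.degree_eq_natDegree hμ0] at hμ ⊢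
  have h1 : μ.natDegree < a := by exact_mod_cast hμ
  calc (μ.natDegree : WithBot ℕ) + q.degree ≤ (μ.natDegree : WithBot ℕ) + (b : WithBot ℕ) := by
        gcongr; exact Polynomial.degree_le_of_natDegree_le hq
    _ < (a + b : ℕ) := by
        rw [← WithBot.coe_natCast, ← WithBot.coe_natCast, ← WithBot.coe_add, ← WithBot.coe_natCast,
          WithBot.coe_lt_coe]
        push_cast; omega

/-- `deg (p ν) < a + b` when `deg p ≤ a` and `deg ν < b`. [folklore] -/
private theorem degree_mul_lt_right {p ν : Polynomial R} {a b : ℕ} (hp : p.natDegree ≤ a)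
    (hν : ν.degree < b) : (p * ν).degree < (a + b : ℕ) := by
  rw [mul_comm, add_comm]; exact degree_mul_lt_left hν hp

/-- The degree of a monic polynomial minus its specialisation drops. [folklore] -/
private theorem degree_sub_lt_of_monic {p q : Polynomial R} [Nontrivial R] (hp : p.Monic)
    (hq : q.Monic) (h : p.natDegree = q.natDegree) : (p - q).degree < p.natDegree := by
  have hd : p.degree = q.degree := by
    rw [Polynomial.degree_eq_natDegree hp.ne_zero, Polynomial.degree_eq_natDegree hq.ne_zero, h]
  have := Polynomial.degree_sub_lt hd hp.ne_zero (by rw [hp.leadingCoeff, hq.leadingCoeff])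
  rwa [Polynomial.degree_eq_natDegree hp.ne_zero] at this

end Degrees

/-! ### The Sylvester map: injectivity from coprimality, and the Bézout corrections -/

section Sylvester

/-- **Injectivity of the Sylvester map** `(μ, ν) ↦ μ Q₀ + P₀ ν` on `deg μ < deg P₀`, over a
domain, from `IsCoprime P₀ Q₀` (`P₀` monic). [folklore] -/
private theorem eq_zero_of_sylvester {R : Type*} [CommRing R] [IsDomain R] {P₀ Q₀ : Polynomial R}
    (hP₀ : P₀.Monic) (hcop : IsCoprime P₀ Q₀) {μ ν : Polynomial R}
    (hμ : μ.degree < P₀.natDegree) (h : μ * Q₀ + P₀ * ν = 0) : μ = 0 ∧ ν = 0 := by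
  have hdvd : P₀ ∣ μ * Q₀ := ⟨-ν, by linear_combination h⟩
  have hμ0 : μ = 0 := by
    refine Polynomial.eq_zero_of_dvd_of_degree_lt (hcop.dvd_of_dvd_mul_right hdvd) ?_
    rwa [Polynomial.degree_eq_natDegree hP₀.ne_zero]
  refine ⟨hμ0, ?_⟩
  rw [hμ0, zero_mul, zero_add] at h
  exact (mul_eq_zero.1 h).resolve_left hP₀.ne_zero

variable {F : Type*} [Field F]

/-- **The Bézout corrections** (columns of the inverse Sylvester map): for coprime `P₀, Q₀` with
`P₀` monic of degree `a` and `Q₀` of degree `b`, every `ℓ` of degree `< a + b` is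
`ℓ = M Q₀ + P₀ N` with `deg M < a`, `deg N < b` (`M = (ℓ t) mod P₀` for a Bézout pair
`s P₀ + t Q₀ = 1`). [cite: Kaltofen1986, §2 (Step L: the linear system of the one-degree lift)] -/
theorem exists_corrections {P₀ Q₀ : Polynomial F} (hP₀ : P₀.Monic)
    (hcop : IsCoprime P₀ Q₀) {ι : Type*} (ℓ : ι → Polynomial F)
    (hℓ : ∀ r, (ℓ r).degree < (P₀.natDegree + Q₀.natDegree : ℕ)) :
    ∃ M N : ι → Polynomial F, (∀ r, M r * Q₀ + P₀ * N r = ℓ r) ∧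
      (∀ r, (M r).degree < P₀.natDegree) ∧ (∀ r, (N r).degree < Q₀.natDegree) := by
  obtain ⟨s, t, hst⟩ := hcop
  have hK : ∀ r, ℓ r - (ℓ r * t) %ₘ P₀ * Q₀ = P₀ * ((ℓ r * t) /ₘ P₀ * Q₀ + ℓ r * s) := by
    intro r
    have h1 := Polynomial.modByMonic_add_div (ℓ r * t) P₀
    have h2 : ℓ r = ℓ r * t * Q₀ + ℓ r * s * P₀ := by
      calc ℓ r = ℓ r * (s * P₀ + t * Q₀) := by rw [hst, mul_one]
        _ = ℓ r * t * Q₀ + ℓ r * s * P₀ := by ring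
    linear_combination h2 - Q₀ * h1
  refine ⟨fun r => (ℓ r * t) %ₘ P₀, fun r => (ℓ r - (ℓ r * t) %ₘ P₀ * Q₀) /ₘ P₀, ?_, ?_, ?_⟩
  · intro r
    simp only
    rw [hK, Polynomial.mul_divByMonic_cancel_left _ hP₀]
    linear_combination (-1 : Polynomial F) * hK r
  · intro r
    have := Polynomial.degree_modByMonic_lt (ℓ r * t) hP₀
    rwa [Polynomial.degree_eq_natDegree hP₀.ne_zero] at this
  · intro r
    simp only
    rw [hK, Polynomial.mul_divByMonic_cancel_left _ hP₀]
    set K := (ℓ r * t) /ₘ P₀ * Q₀ + ℓ r * s with hKdef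
    by_cases hK0 : K = 0
    · rw [hK0, Polynomial.degree_zero]; exact WithBot.bot_lt_coe _
    have hMdeg : ((ℓ r * t) %ₘ P₀).degree < P₀.natDegree := by
      have := Polynomial.degree_modByMonic_lt (ℓ r * t) hP₀
      rwa [Polynomial.degree_eq_natDegree hP₀.ne_zero] at this
    have hD : (P₀ * K).degree < (P₀.natDegree + Q₀.natDegree : ℕ) := by
      rw [← hK]
      refine (Polynomial.degree_sub_le _ _).trans_lt (max_lt (hℓ r) ?_)
      exact degree_mul_lt_left hMdeg le_rfl
    have hPK : (P₀ * K).natDegree = P₀.natDegree + K.natDegree :=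
      Polynomial.natDegree_mul hP₀.ne_zero hK0
    have hPK0 : P₀ * K ≠ 0 := mul_ne_zero hP₀.ne_zero hK0
    rw [Polynomial.degree_eq_natDegree hPK0, Nat.cast_lt, hPK] at hD
    rw [Polynomial.degree_eq_natDegree hK0, Nat.cast_lt]
    omega

end Sylvester

/-! ### Lagrange interpolation over the coefficient domain `F[x]` -/

section LagrangeR

variable {F : Type*} [Field F] {β : Type*}

/-- The Lagrange basis polynomial of a node, pushed to `F[x][Y]`, takes the value `δ_{rs}` at
the nodes. [folklore] -/
private theorem eval_map_basis {m : ℕ} (t : Fin m → F) (ht : Function.Injective t) (r s : Fin m) :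
    ((Lagrange.basis univ t r).map (C : F →+* MvPolynomial β F)).eval (C (t s)) =
      if r = s then 1 else 0 := by
  rw [Polynomial.eval_map, Polynomial.eval₂_at_apply]
  split_ifs with h
  · subst h; rw [Lagrange.eval_basis_self (ht.injOn.mono (Set.subset_univ _)) (mem_univ _), C_1]
  · rw [Lagrange.eval_basis_of_ne h (mem_univ _), C_0]

/-- The pushed Lagrange basis polynomials have degree `< m`. [folklore] -/
private theorem degree_map_basis_lt {m : ℕ} (t : Fin m → F) (ht : Function.Injective t)
    (r : Fin m) :
    ((Lagrange.basis univ t r).map (C : F →+* MvPolynomial β F)).degree < m := by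
  refine (Polynomial.degree_map_le).trans_lt ?_
  rw [Lagrange.degree_basis (ht.injOn.mono (Set.subset_univ _)) (mem_univ _), card_univ,
    Fintype.card_fin]
  have : 0 < m := Fin.pos r
  exact_mod_cast Nat.sub_lt this Nat.one_pos

/-- **Lagrange interpolation over `R = F[x]`**: a polynomial `φ ∈ R[Y]` of degree `< m` is
`Σ_r φ(t_r) · ℓ_r` for `m` distinct scalar nodes `t_r` (the difference has `m` roots `C t_r`
in the domain `R`). [folklore] -/
private theorem eq_sum_eval_mul_basis {m : ℕ} (t : Fin m → F) (ht : Function.Injective t)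
    (φ : Polynomial (MvPolynomial β F)) (hφ : φ.degree < m) :
    φ = ∑ r : Fin m, Polynomial.C (φ.eval (C (t r))) *
      (Lagrange.basis univ t r).map (C : F →+* MvPolynomial β F) := by
  classical
  set D := φ - ∑ r : Fin m, Polynomial.C (φ.eval (C (t r))) *
      (Lagrange.basis univ t r).map (C : F →+* MvPolynomial β F) with hD
  suffices hD0 : D = 0 by rw [hD, sub_eq_zero] at hD0; exact hD0
  rcases Nat.eq_zero_or_pos m with hm | hm
  · subst hm
    have hφ0 : φ = 0 := by
      by_contra h
      rw [Polynomial.degree_eq_natDegree h] at hφ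
      exact absurd hφ (by exact_mod_cast Nat.not_lt_zero _)
    rw [hD, hφ0]
    simp
  have hDmem : D ∈ Polynomial.degreeLT (MvPolynomial β F) m := by
    refine Submodule.sub_mem _ (Polynomial.mem_degreeLT.2 hφ) (Submodule.sum_mem _ fun r _ => ?_)
    rw [Polynomial.C_mul']
    exact Submodule.smul_mem _ _ (Polynomial.mem_degreeLT.2 (degree_map_basis_lt t ht r))
  have hDdeg : D.degree < m := Polynomial.mem_degreeLT.1 hDmem
  have heval : ∀ s : Fin m, D.eval (C (t s)) = 0 := by
    intro s
    rw [hD, Polynomial.eval_sub, Polynomial.eval_finsetSum]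
    simp_rw [Polynomial.eval_mul, Polynomial.eval_C, eval_map_basis t ht, mul_ite, mul_one,
      mul_zero]
    rw [Finset.sum_ite_eq' univ s, if_pos (mem_univ _), sub_self]
  by_contra hD0
  refine hD0 (Polynomial.eq_zero_of_natDegree_lt_card_of_eval_eq_zero D
    (f := fun s : Fin m => C (t s)) ((C_injective β F).comp ht) heval ?_)
  rw [Fintype.card_fin]
  rw [Polynomial.degree_eq_natDegree hD0] at hDdeg
  exact_mod_cast hDdeg

end LagrangeR

/-! ### The inverse Sylvester map in the Lagrange basis, over `R = F[x]` -/

section Inverse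

variable {F : Type*} [Field F] {β : Type*}

/-- **`Σ_r (μ Q₀ + P₀ ν)(t_r) · M_r = μ` and `Σ_r (μ Q₀ + P₀ ν)(t_r) · N_r = ν`** for all
`μ, ν ∈ F[x][Y]` of degrees `< a`, `< b` — the Bézout corrections invert the Sylvester map, over
the coefficient domain `F[x]` (Lagrange interpolation and `eq_zero_of_sylvester`).
[cite: Kaltofen1986, §2 (Step L)] -/
theorem sylvester_inverse {P₀ Q₀ : Polynomial F} (hP₀ : P₀.Monic) (hQ₀ : Q₀.Monic)
    (hcop : IsCoprime P₀ Q₀) {m : ℕ} (hm : P₀.natDegree + Q₀.natDegree = m)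
    (t : Fin m → F) (ht : Function.Injective t) (M N : Fin m → Polynomial F)
    (hMN : ∀ r, M r * Q₀ + P₀ * N r = Lagrange.basis univ t r)
    (hM : ∀ r, (M r).degree < P₀.natDegree)
    (μ ν : Polynomial (MvPolynomial β F)) (hμ : μ.degree < P₀.natDegree)
    (hν : ν.degree < Q₀.natDegree) :
    (∑ r : Fin m, Polynomial.C ((μ * Q₀.map (C : F →+* MvPolynomial β F) +
        P₀.map (C : F →+* MvPolynomial β F) * ν).eval (C (t r))) *
          (M r).map (C : F →+* MvPolynomial β F) = μ) ∧
    (∑ r : Fin m, Polynomial.C ((μ * Q₀.map (C : F →+* MvPolynomial β F) +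
        P₀.map (C : F →+* MvPolynomial β F) * ν).eval (C (t r))) *
          (N r).map (C : F →+* MvPolynomial β F) = ν) := by
  classical
  set ι : F →+* MvPolynomial β F := C with hι
  set P₀' := P₀.map ι with hP₀'
  set Q₀' := Q₀.map ι with hQ₀'
  set φ := μ * Q₀' + P₀' * ν with hφ
  set μ' := ∑ r : Fin m, Polynomial.C (φ.eval (C (t r))) * (M r).map ι with hμ'
  set ν' := ∑ r : Fin m, Polynomial.C (φ.eval (C (t r))) * (N r).map ι with hν'
  have hP₀'m : P₀'.Monic := hP₀.map _
  have hP₀'deg : P₀'.natDegree = P₀.natDegree := hP₀.natDegree_map _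
  have hQ₀'deg : Q₀'.natDegree = Q₀.natDegree := hQ₀.natDegree_map _
  have hcop' : IsCoprime P₀' Q₀' := hcop.map (Polynomial.mapRingHom ι)
  -- `φ` has degree `< m`
  have hφdeg : φ.degree < m := by
    rw [hφ, ← hm]
    refine (Polynomial.degree_add_le _ _).trans_lt (max_lt ?_ ?_)
    · exact degree_mul_lt_left hμ hQ₀'deg.le
    · exact degree_mul_lt_right hP₀'deg.le hν
  -- the Sylvester map applied to `(μ', ν')` gives back `φ`
  have hS : μ' * Q₀' + P₀' * ν' = φ := by
    have hcols : ∀ r, (M r).map ι * Q₀' + P₀' * (N r).map ι = (Lagrange.basis univ t r).map ι := by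
      intro r
      rw [hQ₀', hP₀', ← Polynomial.map_mul, ← Polynomial.map_mul, ← Polynomial.map_add, hMN]
    calc μ' * Q₀' + P₀' * ν'
        = ∑ r : Fin m, Polynomial.C (φ.eval (C (t r))) *
            ((M r).map ι * Q₀' + P₀' * (N r).map ι) := by
          rw [hμ', hν', Finset.sum_mul, Finset.mul_sum, ← Finset.sum_add_distrib]
          refine sum_congr rfl fun r _ => ?_
          ring
      _ = ∑ r : Fin m, Polynomial.C (φ.eval (C (t r))) * (Lagrange.basis univ t r).map ι := by
          simp_rw [hcols]
      _ = φ := (eq_sum_eval_mul_basis t ht φ hφdeg).symm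
  -- degrees of `μ' - μ`
  have hμ'mem : μ' ∈ Polynomial.degreeLT (MvPolynomial β F) P₀.natDegree := by
    refine Submodule.sum_mem _ fun r _ => ?_
    rw [Polynomial.C_mul']
    refine Submodule.smul_mem _ _ (Polynomial.mem_degreeLT.2 ?_)
    exact (Polynomial.degree_map_le).trans_lt (hM r)
  have hdiffdeg : (μ' - μ).degree < P₀'.natDegree := by
    rw [hP₀'deg]
    exact Polynomial.mem_degreeLT.1 (Submodule.sub_mem _ hμ'mem (Polynomial.mem_degreeLT.2 hμ))
  have hzero : (μ' - μ) * Q₀' + P₀' * (ν' - ν) = 0 := by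
    have : (μ' - μ) * Q₀' + P₀' * (ν' - ν) = (μ' * Q₀' + P₀' * ν') - (μ * Q₀' + P₀' * ν) := by ring
    rw [this, hS, hφ, sub_self]
  obtain ⟨h1, h2⟩ := eq_zero_of_sylvester hP₀'m hcop' hdiffdeg hzero
  exact ⟨sub_eq_zero.1 h1, sub_eq_zero.1 h2⟩

end Inverse

/-! ### The linear Hensel iteration and its invariant -/

section Iteration

variable {F : Type*} [Field F] {β : Type*}

/-- **Invariant of the linear Hensel iteration** (Kaltofen 1986, §2, Steps H/L, slow-Newton
form). Data: `P, Q ∈ F[x][Y]` monic with `P(0, Y), Q(0, Y)` coprime; `m = deg P + deg Q`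
distinct nodes `t_r`; Bézout corrections `M_r, N_r` (`exists_corrections`); the iteration
`step (U, W) = (U + Σ_r E(t_r) M_r, W + Σ_r E(t_r) N_r)`, `E = P Q - U W`, started at
`(P(0, Y), Q(0, Y))`. Then after `k` steps `P - U_k` has degree `< deg P`, `Q - W_k` degree
`< deg Q`, and all their `x`-coefficients vanish to order `k + 1`.
[cite: Kaltofen1986, §2 (Steps H and L) and Thm. 2.1] -/
theorem iterate_invariant (P Q : Polynomial (MvPolynomial β F)) (hP : P.Monic) (hQ : Q.Monic)
    (hcop : IsCoprime (P.map (constantCoeff : MvPolynomial β F →+* F))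
      (Q.map (constantCoeff : MvPolynomial β F →+* F)))
    {m : ℕ} (hm : P.natDegree + Q.natDegree = m) (t : Fin m → F) (ht : Function.Injective t)
    (M N : Fin m → Polynomial F)
    (hMN : ∀ r, M r * Q.map (constantCoeff : MvPolynomial β F →+* F) +
      P.map (constantCoeff : MvPolynomial β F →+* F) * N r = Lagrange.basis univ t r)
    (hM : ∀ r, (M r).degree < P.natDegree) (hN : ∀ r, (N r).degree < Q.natDegree)
    (step : Polynomial (MvPolynomial β F) × Polynomial (MvPolynomial β F) →
      Polynomial (MvPolynomial β F) × Polynomial (MvPolynomial β F))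
    (hstep : ∀ UW, step UW =
      (UW.1 + ∑ r : Fin m, Polynomial.C ((P * Q - UW.1 * UW.2).eval (C (t r))) *
          (M r).map (C : F →+* MvPolynomial β F),
       UW.2 + ∑ r : Fin m, Polynomial.C ((P * Q - UW.1 * UW.2).eval (C (t r))) *
          (N r).map (C : F →+* MvPolynomial β F)))
    (k : ℕ) :
    (P - (step^[k] (P.map ((C : F →+* MvPolynomial β F).comp constantCoeff),
        Q.map ((C : F →+* MvPolynomial β F).comp constantCoeff))).1).degree < P.natDegree ∧
    (Q - (step^[k] (P.map ((C : F →+* MvPolynomial β F).comp constantCoeff),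
        Q.map ((C : F →+* MvPolynomial β F).comp constantCoeff))).2).degree < Q.natDegree ∧
    (∀ n, ∀ i < k + 1, homogeneousComponent i ((P - (step^[k]
        (P.map ((C : F →+* MvPolynomial β F).comp constantCoeff),
         Q.map ((C : F →+* MvPolynomial β F).comp constantCoeff))).1).coeff n) = 0) ∧
    (∀ n, ∀ i < k + 1, homogeneousComponent i ((Q - (step^[k]
        (P.map ((C : F →+* MvPolynomial β F).comp constantCoeff),
         Q.map ((C : F →+* MvPolynomial β F).comp constantCoeff))).2).coeff n) = 0) := by
  classical
  set ι : F →+* MvPolynomial β F := C with hι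
  set cc : MvPolynomial β F →+* F := constantCoeff with hcc
  set P₀ := P.map cc with hP₀
  set Q₀ := Q.map cc with hQ₀
  set P₀' := P.map (ι.comp cc) with hP₀'
  set Q₀' := Q.map (ι.comp cc) with hQ₀'
  have hP₀'eq : P₀' = P₀.map ι := by rw [hP₀', hP₀, Polynomial.map_map]
  have hQ₀'eq : Q₀' = Q₀.map ι := by rw [hQ₀', hQ₀, Polynomial.map_map]
  have hP₀m : P₀.Monic := hP.map _
  have hQ₀m : Q₀.Monic := hQ.map _
  have hP₀deg : P₀.natDegree = P.natDegree := hP.natDegree_map _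
  have hQ₀deg : Q₀.natDegree = Q.natDegree := hQ.natDegree_map _
  have hP₀'m : P₀'.Monic := hP.map _
  have hQ₀'m : Q₀'.Monic := hQ.map _
  have hP₀'deg : P₀'.natDegree = P.natDegree := hP.natDegree_map _
  have hQ₀'deg : Q₀'.natDegree = Q.natDegree := hQ.natDegree_map _
  -- order-one vanishing of `P - P₀'`, `Q - Q₀'`
  have hPv : ∀ n, ∀ i < 1, homogeneousComponent i ((P - P₀').coeff n) = 0 :=
    pvanish_sub_map_constantCoeff P
  have hQv : ∀ n, ∀ i < 1, homogeneousComponent i ((Q - Q₀').coeff n) = 0 :=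
    pvanish_sub_map_constantCoeff Q
  induction k with
  | zero =>
    simp only [Function.iterate_zero, id_eq, zero_add]
    exact ⟨degree_sub_lt_of_monic hP hP₀'m hP₀'deg.symm,
      degree_sub_lt_of_monic hQ hQ₀'m hQ₀'deg.symm, hPv, hQv⟩
  | succ k ih =>
    rw [Function.iterate_succ_apply']
    set UW := step^[k] (P₀', Q₀') with hUW
    obtain ⟨hδdeg, hεdeg, hδv, hεv⟩ := ih
    set U := UW.1 with hU
    set W := UW.2 with hW
    set δ := P - U with hδ
    set ε := Q - W with hε
    set E := P * Q - U * W with hE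
    set S := δ * Q₀' + P₀' * ε with hS
    set Rm := E - S with hRm
    set ΔU := ∑ r : Fin m, Polynomial.C (E.eval (C (t r))) * (M r).map ι with hΔU
    set ΔW := ∑ r : Fin m, Polynomial.C (E.eval (C (t r))) * (N r).map ι with hΔW
    have hstepUW : step UW = (U + ΔU, W + ΔW) := by rw [hstep UW]
    rw [hstepUW]
    simp only
    -- the key congruence: `E ≡ S` to order `k + 2`
    have hEeq : E = δ * W + P * ε := by rw [hE, hδ, hε]; ring
    have hRmeq : Rm = δ * (W - Q₀') + (P - P₀') * ε := by rw [hRm, hS, hEeq]; ring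
    have hWQ : ∀ n, ∀ i < 1, homogeneousComponent i ((W - Q₀').coeff n) = 0 := by
      have : W - Q₀' = (Q - Q₀') - ε := by rw [hε]; ring
      rw [this]
      exact pvanish_sub hQv (pvanish_mono (by omega) hεv)
    have hRmv : ∀ n, ∀ i < k + 1 + 1, homogeneousComponent i (Rm.coeff n) = 0 := by
      rw [hRmeq]
      refine pvanish_add (pvanish_mul hδv hWQ) ?_
      have h := pvanish_mul hPv hεv
      rwa [add_comm 1 (k + 1)] at h
    -- the exact inverse on `S`
    have hμν := sylvester_inverse (β := β) hP₀m hQ₀m hcop (by rw [hP₀deg, hQ₀deg]; exact hm)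
      t ht M N hMN (fun r => by rw [hP₀deg]; exact hM r)
      δ ε (by rw [hP₀deg]; exact hδdeg) (by rw [hQ₀deg]; exact hεdeg)
    rw [← hP₀'eq, ← hQ₀'eq] at hμν
    obtain ⟨hμ, hν⟩ := hμν
    -- split `ΔU = δ + Σ_r Rm(t_r) M_r`, `ΔW = ε + Σ_r Rm(t_r) N_r`
    have hEsplit : E = S + Rm := by rw [hRm]; ring
    have hΔUeq : ΔU = δ + ∑ r : Fin m, Polynomial.C (Rm.eval (C (t r))) * (M r).map ι := by
      rw [hΔU]
      conv_lhs => rw [hEsplit]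
      simp_rw [Polynomial.eval_add, Polynomial.C_add, add_mul, Finset.sum_add_distrib]
      rw [hS, hμ]
    have hΔWeq : ΔW = ε + ∑ r : Fin m, Polynomial.C (Rm.eval (C (t r))) * (N r).map ι := by
      rw [hΔW]
      conv_lhs => rw [hEsplit]
      simp_rw [Polynomial.eval_add, Polynomial.C_add, add_mul, Finset.sum_add_distrib]
      rw [hS, hν]
    have hδ' : P - (U + ΔU) = -∑ r : Fin m, Polynomial.C (Rm.eval (C (t r))) * (M r).map ι := by
      rw [hΔUeq, hδ]; ring
    have hε' : Q - (W + ΔW) = -∑ r : Fin m, Polynomial.C (Rm.eval (C (t r))) * (N r).map ι := by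
      rw [hΔWeq, hε]; ring
    refine ⟨?_, ?_, ?_, ?_⟩
    · -- degree of `P - U'`
      rw [hδ']
      refine Polynomial.mem_degreeLT.1 (Submodule.neg_mem _ (Submodule.sum_mem _ fun r _ => ?_))
      rw [Polynomial.C_mul']
      exact Submodule.smul_mem _ _
        (Polynomial.mem_degreeLT.2 ((Polynomial.degree_map_le).trans_lt (hM r)))
    · rw [hε']
      refine Polynomial.mem_degreeLT.1 (Submodule.neg_mem _ (Submodule.sum_mem _ fun r _ => ?_))
      rw [Polynomial.C_mul']
      exact Submodule.smul_mem _ _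
        (Polynomial.mem_degreeLT.2 ((Polynomial.degree_map_le).trans_lt (hN r)))
    · rw [hδ']
      intro n
      rw [Polynomial.coeff_neg]
      refine vanish_neg ((pvanish_sum _ fun r _ => ?_) n)
      exact pvanish_C_mul (vanish_eval_C hRmv (t r)) _
    · rw [hε']
      intro n
      rw [Polynomial.coeff_neg]
      refine vanish_neg ((pvanish_sum _ fun r _ => ?_) n)
      exact pvanish_C_mul (vanish_eval_C hRmv (t r)) _

end Iteration

/-! ### Cost: the node values evolve by one fixed polynomial map -/

section Cost

variable {F : Type*} [Field F] {β : Type*}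

/-- `L(x_i^e) ≤ e`. [folklore] -/
private theorem complexity_X_pow_le {σ : Type*} (i : σ) (e : ℕ) :
    complexity (X i ^ e : MvPolynomial σ F) ≤ e := by
  classical
  have h := complexity_finset_prod_le (Finset.range e) (fun _ => (X i : MvPolynomial σ F))
  rw [Finset.prod_const, Finset.card_range] at h
  refine h.trans ?_
  rw [Finset.sum_eq_zero fun j _ => complexity_X_holds (k := F) i, zero_add]

/-- `optionEquivLeft` turns substitution for `y` into evaluation. [folklore] -/
private theorem eval_optionEquivLeft (H : MvPolynomial (Option β) F) (z : MvPolynomial β F) :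
    Polynomial.eval z (optionEquivLeft F β H) = aeval (fun o : Option β => o.elim z X) H := by
  have key : ((Polynomial.aeval z : Polynomial (MvPolynomial β F) →ₐ[MvPolynomial β F]
      MvPolynomial β F).restrictScalars F).comp
        (optionEquivLeft F β : MvPolynomial (Option β) F →ₐ[F] Polynomial (MvPolynomial β F)) =
      aeval (fun o : Option β => o.elim z X) := by
    refine MvPolynomial.algHom_ext fun o => ?_
    rcases o with _ | b
    · simp
    · simp
  have := AlgHom.congr_fun key H
  simpa [Polynomial.coe_aeval_eq_eval] using this

/-- `optionEquivLeft.symm` on constants of `F[x][Y]` is `rename some`. [folklore] -/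
private theorem optionEquivLeft_symm_polynomialC (u : MvPolynomial β F) :
    (optionEquivLeft F β).symm (Polynomial.C u) = rename some u := by
  simp only [optionEquivLeft_symm_apply, Polynomial.aevalTower_C]

/-- A scalar univariate polynomial of degree `< m`, read in `F[x, y]`, costs `≤ m (m + 1)`.
[folklore] -/
private theorem complexity_symm_map_le (φ : Polynomial F) {m : ℕ} (hφ : φ.degree < m) :
    complexity ((optionEquivLeft F β).symm (φ.map (C : F →+* MvPolynomial β F))) ≤
      m * (m + 1) := by
  classical
  have hdeg : (φ.map (C : F →+* MvPolynomial β F)).natDegree < m ∨ m = 0 := by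
    rcases Nat.eq_zero_or_pos m with hm | hm
    · exact Or.inr hm
    left
    refine lt_of_le_of_lt Polynomial.natDegree_map_le ?_
    by_cases h0 : φ = 0
    · rw [h0, Polynomial.natDegree_zero]; exact hm
    · rw [Polynomial.degree_eq_natDegree h0] at hφ; exact_mod_cast hφ
  rcases hdeg with hdeg | hm
  · rw [Polynomial.as_sum_range' _ m hdeg, map_sum]
    calc complexity (∑ i ∈ range m, (optionEquivLeft F β).symm
          (Polynomial.monomial i ((φ.map (C : F →+* MvPolynomial β F)).coeff i)))
        ≤ ∑ i ∈ range m, complexity ((optionEquivLeft F β).symm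
            (Polynomial.monomial i ((φ.map (C : F →+* MvPolynomial β F)).coeff i))) +
            (range m).card := complexity_finset_sum_le _ _
      _ ≤ ∑ _i ∈ range m, m + (range m).card := by
          gcongr with i hi
          rw [Polynomial.coeff_map, ← Polynomial.C_mul_X_pow_eq_monomial, map_mul, map_pow,
            optionEquivLeft_symm_X, optionEquivLeft_symm_C_C]
          calc complexity (C (φ.coeff i) * X none ^ i : MvPolynomial (Option β) F)
              ≤ complexity (C (φ.coeff i) : MvPolynomial (Option β) F) +
                  complexity (X none ^ i : MvPolynomial (Option β) F) + 1 :=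
                complexity_mul_le_holds _ _
            _ ≤ 0 + i + 1 := by
                gcongr
                · exact (complexity_C_holds _).le
                · exact complexity_X_pow_le _ _
            _ ≤ m := by have := mem_range.1 hi; omega
      _ = m * (m + 1) := by rw [sum_const, card_range, smul_eq_mul]; ring
  · subst hm
    have hφ0 : φ = 0 := by
      by_contra h
      rw [Polynomial.degree_eq_natDegree h] at hφ
      exact absurd hφ (by exact_mod_cast Nat.not_lt_zero _)
    rw [hφ0, Polynomial.map_zero, map_zero, ← C_0, complexity_C_holds]

variable [Fintype β]

/-- **Cost of one component of the step map** `Φ_j = w_j + Σ_r c_r · (G(x, t_r) - u_r w_r)`: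
`≤ m (L(G) + 5) + 1`. [cite: Kaltofen1986, §2 (Step L, cost count)] -/
theorem complexity_stepPoly_le (G : MvPolynomial (Option β) F) {m : ℕ} (t : Fin m → F)
    (c : Fin m → F) (j : Fin m ⊕ Fin m) :
    complexity (X (Sum.inr j) + ∑ r : Fin m, C (c r) *
      (rename Sum.inl (aeval (fun o : Option β => o.elim (C (t r)) X) G) -
        X (Sum.inr (Sum.inl r)) * X (Sum.inr (Sum.inr r))) :
          MvPolynomial (β ⊕ (Fin m ⊕ Fin m)) F) ≤ m * (complexity G + 5) + 1 := by
  classical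
  have hGr : ∀ r, complexity (rename (Sum.inl : β → β ⊕ (Fin m ⊕ Fin m))
      (aeval (fun o : Option β => o.elim (C (t r)) X) G)) ≤ complexity G := by
    intro r
    refine (complexity_rename_le_holds' _ _).trans ?_
    refine (complexity_aeval_le _ _).trans ?_
    have hsumX : ∑ b : β, complexity (X b : MvPolynomial β F) = 0 :=
      Finset.sum_eq_zero fun b _ => complexity_X_holds (k := F) b
    rw [Fintype.sum_option]
    simp only [Option.elim_none, Option.elim_some, hsumX, add_zero,
      complexity_C_holds (k := F) (σ := β) (t r)]
    exact le_rfl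
  have hterm : ∀ r, complexity (C (c r) *
      (rename Sum.inl (aeval (fun o : Option β => o.elim (C (t r)) X) G) -
        X (Sum.inr (Sum.inl r)) * X (Sum.inr (Sum.inr r))) :
          MvPolynomial (β ⊕ (Fin m ⊕ Fin m)) F) ≤ complexity G + 4 := by
    intro r
    have hsub : (rename Sum.inl (aeval (fun o : Option β => o.elim (C (t r)) X) G) -
        X (Sum.inr (Sum.inl r)) * X (Sum.inr (Sum.inr r)) :
          MvPolynomial (β ⊕ (Fin m ⊕ Fin m)) F) =
        rename Sum.inl (aeval (fun o : Option β => o.elim (C (t r)) X) G) +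
          C (-1) * (X (Sum.inr (Sum.inl r)) * X (Sum.inr (Sum.inr r))) := by
      rw [map_neg, map_one]; ring
    calc complexity (C (c r) *
          (rename Sum.inl (aeval (fun o : Option β => o.elim (C (t r)) X) G) -
            X (Sum.inr (Sum.inl r)) * X (Sum.inr (Sum.inr r))) :
              MvPolynomial (β ⊕ (Fin m ⊕ Fin m)) F)
        ≤ complexity (C (c r) : MvPolynomial (β ⊕ (Fin m ⊕ Fin m)) F) +
            complexity (rename Sum.inl (aeval (fun o : Option β => o.elim (C (t r)) X) G) -
              X (Sum.inr (Sum.inl r)) * X (Sum.inr (Sum.inr r)) :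
                MvPolynomial (β ⊕ (Fin m ⊕ Fin m)) F) + 1 := complexity_mul_le_holds _ _
      _ ≤ 0 + (complexity G + 3) + 1 := by
          gcongr
          · exact (complexity_C_holds _).le
          · rw [hsub]
            calc _ ≤ complexity (rename Sum.inl
                    (aeval (fun o : Option β => o.elim (C (t r)) X) G) :
                      MvPolynomial (β ⊕ (Fin m ⊕ Fin m)) F) +
                    complexity (C (-1) * (X (Sum.inr (Sum.inl r)) * X (Sum.inr (Sum.inr r))) :
                      MvPolynomial (β ⊕ (Fin m ⊕ Fin m)) F) + 1 := complexity_add_le_holds _ _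
              _ ≤ complexity G + (0 + (0 + 0 + 1) + 1) + 1 := by
                  gcongr
                  · exact hGr r
                  · calc _ ≤ complexity (C (-1) : MvPolynomial (β ⊕ (Fin m ⊕ Fin m)) F) +
                          complexity (X (Sum.inr (Sum.inl r)) * X (Sum.inr (Sum.inr r)) :
                            MvPolynomial (β ⊕ (Fin m ⊕ Fin m)) F) + 1 :=
                          complexity_mul_le_holds _ _
                      _ ≤ 0 + (0 + 0 + 1) + 1 := by
                          gcongr
                          · exact (complexity_C_holds _).le
                          · calc _ ≤ complexity (X (Sum.inr (Sum.inl r)) :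
                                    MvPolynomial (β ⊕ (Fin m ⊕ Fin m)) F) +
                                  complexity (X (Sum.inr (Sum.inr r)) :
                                    MvPolynomial (β ⊕ (Fin m ⊕ Fin m)) F) + 1 :=
                                  complexity_mul_le_holds _ _
                              _ = 0 + 0 + 1 := by rw [complexity_X_holds, complexity_X_holds]
              _ = complexity G + 3 := by ring
      _ = complexity G + 4 := by ring
  calc _ ≤ complexity (X (Sum.inr j) : MvPolynomial (β ⊕ (Fin m ⊕ Fin m)) F) +
        complexity (∑ r : Fin m, C (c r) *
          (rename Sum.inl (aeval (fun o : Option β => o.elim (C (t r)) X) G) -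
            X (Sum.inr (Sum.inl r)) * X (Sum.inr (Sum.inr r))) :
              MvPolynomial (β ⊕ (Fin m ⊕ Fin m)) F) + 1 := complexity_add_le_holds _ _
    _ ≤ 0 + (∑ r : Fin m, (complexity G + 4) + (univ : Finset (Fin m)).card) + 1 := by
        gcongr
        · exact (complexity_X_holds _).le
        · exact (complexity_finset_sum_le _ _).trans (by gcongr with r _; exact hterm r)
    _ = m * (complexity G + 5) + 1 := by
        rw [sum_const, card_univ, Fintype.card_fin, smul_eq_mul]; ring

/-- **Iterating a fixed polynomial map costs additively** ("iterate as the OUTER function"): if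
every component `Φ_j` (`j ∈ τs`) of a polynomial map in the state variables `τs` (and parameters
`β`) costs `≤ B`, then the `k`-fold formal composite `w_j ∘ Φ ∘ ⋯ ∘ Φ` costs `≤ k · |τs| · B`
(`complexity_aeval_le`: substituting `Φ` into the previous composite adds `Σ_j L(Φ_j)`).
[cite: Burgisser2000, Rem. 2.7] -/
theorem complexity_iterate_le {τs : Type*} [Fintype τs] (Φ : τs → MvPolynomial (β ⊕ τs) F)
    {B : ℕ} (hΦ : ∀ j, complexity (Φ j) ≤ B) (k : ℕ) (j : τs) :
    complexity (((fun v : τs → MvPolynomial (β ⊕ τs) F => fun j => bind₁ (Sum.elim (X ∘ Sum.inl) Φ)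
      (v j))^[k] (fun j => X (Sum.inr j))) j) ≤ k * (Fintype.card τs * B) := by
  classical
  induction k with
  | zero =>
    rw [Function.iterate_zero, id_eq, complexity_X_holds]
    exact Nat.zero_le _
  | succ k ih =>
    rw [Function.iterate_succ_apply', ← aeval_eq_bind₁]
    refine (complexity_aeval_le _ _).trans ?_
    rw [Fintype.sum_sum_type]
    have hX : ∑ x : β, complexity (Sum.elim (X ∘ Sum.inl) Φ (Sum.inl x) :
        MvPolynomial (β ⊕ τs) F) = 0 :=
      Finset.sum_eq_zero fun x _ => complexity_X_holds (k := F) _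
    rw [hX, zero_add]
    calc _ ≤ k * (Fintype.card τs * B) + ∑ _j : τs, B := by
          gcongr with j' _
          · exact ih
          · exact hΦ j'
      _ = (k + 1) * (Fintype.card τs * B) := by rw [sum_const, card_univ, smul_eq_mul]; ring

omit [Fintype β] in
/-- **Semantics of the formal composite**: evaluating the `k`-fold composite at a state vector
`v` gives the `k`-th iterate of the map `w ↦ (Φ_j(x, w))_j` started at `v`. [folklore] -/
private theorem aeval_iterate_eq {τs : Type*} (Φ : τs → MvPolynomial (β ⊕ τs) F)
    (v : τs → MvPolynomial β F) (k : ℕ) (j : τs) :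
    aeval (Sum.elim X v) (((fun u : τs → MvPolynomial (β ⊕ τs) F => fun j =>
      bind₁ (Sum.elim (X ∘ Sum.inl) Φ) (u j))^[k] (fun j => X (Sum.inr j))) j) =
      ((fun w : τs → MvPolynomial β F => fun j => aeval (Sum.elim X w) (Φ j))^[k] v) j := by
  induction k generalizing v with
  | zero => simp
  | succ k ih =>
    rw [Function.iterate_succ_apply', Function.iterate_succ_apply, aeval_bind₁]
    have hfun : (fun i : β ⊕ τs => aeval (Sum.elim X v) (Sum.elim (X ∘ Sum.inl) Φ i)) =
        Sum.elim X (fun j => aeval (Sum.elim X v) (Φ j)) := by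
      funext i
      rcases i with x | j'
      · simp
      · simp
    rw [hfun, ih]

end Cost

/-! ### The node values of the Hensel iteration -/

section NodeValues

variable {F : Type*} [Field F] {β : Type*}

/-- **The node values follow the step map**: with `u_s = U_k(t_s)`, `w_s = W_k(t_s)` and
`Φ` the polynomial map `u_s ↦ u_s + Σ_r M_r(t_s) (G(x, t_r) - u_r w_r)`,
`w_s ↦ w_s + Σ_r N_r(t_s) (G(x, t_r) - u_r w_r)` (`G = P Q`), the node values of the `k`-th
Hensel iterate are the `k`-th iterate of `Φ` on the node values of `(P(0, Y), Q(0, Y))`.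
[cite: Kaltofen1986, §2 (Step L)] -/
theorem eval_iterate_step (G : MvPolynomial (Option β) F) (P Q : Polynomial (MvPolynomial β F))
    (hG : optionEquivLeft F β G = P * Q) {m : ℕ} (t : Fin m → F)
    (M N : Fin m → Polynomial F)
    (step : Polynomial (MvPolynomial β F) × Polynomial (MvPolynomial β F) →
      Polynomial (MvPolynomial β F) × Polynomial (MvPolynomial β F))
    (hstep : ∀ UW, step UW =
      (UW.1 + ∑ r : Fin m, Polynomial.C ((P * Q - UW.1 * UW.2).eval (C (t r))) *
          (M r).map (C : F →+* MvPolynomial β F),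
       UW.2 + ∑ r : Fin m, Polynomial.C ((P * Q - UW.1 * UW.2).eval (C (t r))) *
          (N r).map (C : F →+* MvPolynomial β F)))
    (Φ : Fin m ⊕ Fin m → MvPolynomial (β ⊕ (Fin m ⊕ Fin m)) F)
    (hΦl : ∀ s, Φ (Sum.inl s) = X (Sum.inr (Sum.inl s)) + ∑ r : Fin m, C ((M r).eval (t s)) *
      (rename Sum.inl (aeval (fun o : Option β => o.elim (C (t r)) X) G) -
        X (Sum.inr (Sum.inl r)) * X (Sum.inr (Sum.inr r))))
    (hΦr : ∀ s, Φ (Sum.inr s) = X (Sum.inr (Sum.inr s)) + ∑ r : Fin m, C ((N r).eval (t s)) *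
      (rename Sum.inl (aeval (fun o : Option β => o.elim (C (t r)) X) G) -
        X (Sum.inr (Sum.inl r)) * X (Sum.inr (Sum.inr r))))
    (k : ℕ) :
    (fun j : Fin m ⊕ Fin m => Sum.elim
        (fun s => (step^[k] (P.map ((C : F →+* MvPolynomial β F).comp constantCoeff),
          Q.map ((C : F →+* MvPolynomial β F).comp constantCoeff))).1.eval (C (t s)))
        (fun s => (step^[k] (P.map ((C : F →+* MvPolynomial β F).comp constantCoeff),
          Q.map ((C : F →+* MvPolynomial β F).comp constantCoeff))).2.eval (C (t s))) j) =
      (fun w : Fin m ⊕ Fin m → MvPolynomial β F => fun j => aeval (Sum.elim X w) (Φ j))^[k]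
        (Sum.elim (fun s => C ((P.map (constantCoeff : MvPolynomial β F →+* F)).eval (t s)))
          (fun s => C ((Q.map (constantCoeff : MvPolynomial β F →+* F)).eval (t s)))) := by
  classical
  have hGr : ∀ r, (P.eval (C (t r))) * (Q.eval (C (t r))) =
      aeval (fun o : Option β => o.elim (C (t r)) X) G := by
    intro r; rw [← Polynomial.eval_mul, ← hG, eval_optionEquivLeft]
  have hren : ∀ (w : Fin m ⊕ Fin m → MvPolynomial β F) r,
      aeval (Sum.elim X w) (rename (Sum.inl : β → β ⊕ (Fin m ⊕ Fin m))
        (aeval (fun o : Option β => o.elim (C (t r)) X) G)) =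
        aeval (fun o : Option β => o.elim (C (t r)) X) G := by
    intro w r
    rw [aeval_rename, Sum.elim_comp_inl, aeval_X_left_apply]
  have hmapev : ∀ (φ : Polynomial F) (s : Fin m),
      (φ.map (C : F →+* MvPolynomial β F)).eval (C (t s)) = C (φ.eval (t s)) := by
    intro φ s; rw [Polynomial.eval_map, Polynomial.eval₂_at_apply]
  induction k with
  | zero =>
    funext j
    simp only [Function.iterate_zero, id_eq]
    rcases j with s | s
    · simp only [Sum.elim_inl]
      rw [← Polynomial.map_map, hmapev]
    · simp only [Sum.elim_inr]
      rw [← Polynomial.map_map, hmapev]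
  | succ k ih =>
    rw [Function.iterate_succ_apply', Function.iterate_succ_apply', ← ih]
    set UW := step^[k] (P.map ((C : F →+* MvPolynomial β F).comp constantCoeff),
      Q.map ((C : F →+* MvPolynomial β F).comp constantCoeff)) with hUW
    funext j
    rcases j with s | s
    · simp only [Sum.elim_inl]
      rw [hstep UW, hΦl s]
      simp only [map_add, map_sum, map_mul, map_sub, aeval_C, aeval_X, Sum.elim_inr, Sum.elim_inl,
        algebraMap_eq, Polynomial.eval_add, Polynomial.eval_finsetSum, Polynomial.eval_mul,
        Polynomial.eval_C, Polynomial.eval_sub]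
      refine congrArg _ (sum_congr rfl fun r _ => ?_)
      rw [hmapev, hren, ← hGr]
      ring
    · simp only [Sum.elim_inr]
      rw [hstep UW, hΦr s]
      simp only [map_add, map_sum, map_mul, map_sub, aeval_C, aeval_X, Sum.elim_inr, Sum.elim_inl,
        algebraMap_eq, Polynomial.eval_add, Polynomial.eval_finsetSum, Polynomial.eval_mul,
        Polynomial.eval_C, Polynomial.eval_sub]
      refine congrArg _ (sum_congr rfl fun r _ => ?_)
      rw [hmapev, hren, ← hGr]
      ring

end NodeValues

/-! ### Main theorem -/

section Main

variable {F : Type*} [Field F] {β : Type*} [Fintype β]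

/-- **Kaltofen's single-factor Hensel lifting, as a circuit bound over every field.** Let
`G, P̂ ∈ F[x_β, y]` with `optionEquivLeft G = P · Q`, `P, Q ∈ F[x][Y]` monic,
`optionEquivLeft P̂ = a₀ · P`, and suppose `P(0, Y)`, `Q(0, Y)` are COPRIME in `F[Y]` (no
separability is assumed: `P` may be a `p^e`-th power in characteristic `p`). If
`t : Fin m → F` (`m = deg P + deg Q`) is injective, then for every `N ≥ deg P̂`,
`L(P̂) ≤ (N+2)² · (m · (2·N·m·(m·(L(G)+5)+1) + m·(m+1) + 2) + 2m + 2) + (N + 1)` — `P̂` is the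
truncation at degree `N` of `a₀ · U_N(x, y)` for the `N`-th linear Hensel iterate `U_N`
(`iterate_invariant`), whose node values `U_N(x, t_s)` are computed by composing one fixed
polynomial map `N` times (`complexity_iterate_le`, `eval_iterate_step`) and which is
re-assembled by Lagrange interpolation in `y`.
[cite: Kaltofen1986, §2 (Algorithm Factorization, Steps H and L) and Thm. 2.1; Kaltofen1989, Thm. 5] -/
theorem complexity_le_of_coprimeFactors (G Ph : MvPolynomial (Option β) F) (a₀ : F)
    (P Q : Polynomial (MvPolynomial β F)) (hP : P.Monic) (hQ : Q.Monic)
    (hG : optionEquivLeft F β G = P * Q)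
    (hPh : optionEquivLeft F β Ph = Polynomial.C (C a₀) * P)
    (hcop : IsCoprime (P.map (constantCoeff : MvPolynomial β F →+* F))
      (Q.map (constantCoeff : MvPolynomial β F →+* F)))
    {m : ℕ} (hm : P.natDegree + Q.natDegree = m) (t : Fin m → F) (ht : Function.Injective t)
    {N : ℕ} (hN : Ph.totalDegree ≤ N) :
    complexity Ph ≤ (N + 2) ^ 2 * (m * (2 * N * m * (m * (complexity G + 5) + 1) +
      m * (m + 1) + 2) + 2 * m + 2) + (N + 1) := by
  classical
  have hP₀m : (P.map (constantCoeff : MvPolynomial β F →+* F)).Monic := hP.map _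
  have hQ₀m : (Q.map (constantCoeff : MvPolynomial β F →+* F)).Monic := hQ.map _
  have hP₀deg : (P.map (constantCoeff : MvPolynomial β F →+* F)).natDegree = P.natDegree :=
    hP.natDegree_map _
  have hQ₀deg : (Q.map (constantCoeff : MvPolynomial β F →+* F)).natDegree = Q.natDegree :=
    hQ.natDegree_map _
  have ham : P.natDegree ≤ m := by omega
  -- Bézout corrections
  have hℓ : ∀ r : Fin m, (Lagrange.basis univ t r).degree <
      ((P.map (constantCoeff : MvPolynomial β F →+* F)).natDegree +
        (Q.map (constantCoeff : MvPolynomial β F →+* F)).natDegree : ℕ) := by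
    intro r
    rw [hP₀deg, hQ₀deg, hm, Lagrange.degree_basis (ht.injOn.mono (Set.subset_univ _)) (mem_univ _),
      card_univ, Fintype.card_fin]
    have : 0 < m := Fin.pos r
    exact_mod_cast Nat.sub_lt this Nat.one_pos
  obtain ⟨M, Nn, hMN, hM, hNn⟩ := exists_corrections hP₀m hcop (fun r => Lagrange.basis univ t r) hℓ
  rw [hP₀deg] at hM
  rw [hQ₀deg] at hNn
  -- the iteration
  set step : Polynomial (MvPolynomial β F) × Polynomial (MvPolynomial β F) →
      Polynomial (MvPolynomial β F) × Polynomial (MvPolynomial β F) := fun UW =>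
    (UW.1 + ∑ r : Fin m, Polynomial.C ((P * Q - UW.1 * UW.2).eval (C (t r))) *
      (M r).map (C : F →+* MvPolynomial β F),
     UW.2 + ∑ r : Fin m, Polynomial.C ((P * Q - UW.1 * UW.2).eval (C (t r))) *
      (Nn r).map (C : F →+* MvPolynomial β F))
    with hstepdef
  have hstep : ∀ UW, step UW =
      (UW.1 + ∑ r : Fin m, Polynomial.C ((P * Q - UW.1 * UW.2).eval (C (t r))) *
        (M r).map (C : F →+* MvPolynomial β F),
       UW.2 + ∑ r : Fin m, Polynomial.C ((P * Q - UW.1 * UW.2).eval (C (t r))) *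
        (Nn r).map (C : F →+* MvPolynomial β F)) :=
    fun UW => rfl
  obtain ⟨hδdeg, -, hδv, -⟩ := iterate_invariant P Q hP hQ hcop hm t ht M Nn hMN hM hNn step hstep N
  set init : Polynomial (MvPolynomial β F) × Polynomial (MvPolynomial β F) :=
    (P.map ((C : F →+* MvPolynomial β F).comp constantCoeff),
     Q.map ((C : F →+* MvPolynomial β F).comp constantCoeff)) with hinit
  set UN := (step^[N] init).1 with hUN
  -- `P̂` is the truncation of `a₀ · U_N`
  have heq := KaltofenFactor.eq_sum_homogeneousComponent_of_coeff_vanish Ph a₀ P UN hPh hδv hN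
  -- node values and their cost
  set Φ : Fin m ⊕ Fin m → MvPolynomial (β ⊕ (Fin m ⊕ Fin m)) F := fun j => Sum.elim
    (fun s => X (Sum.inr (Sum.inl s)) + ∑ r : Fin m, C ((M r).eval (t s)) *
      (rename Sum.inl (aeval (fun o : Option β => o.elim (C (t r)) X) G) -
        X (Sum.inr (Sum.inl r)) * X (Sum.inr (Sum.inr r))))
    (fun s => X (Sum.inr (Sum.inr s)) + ∑ r : Fin m, C ((Nn r).eval (t s)) *
      (rename Sum.inl (aeval (fun o : Option β => o.elim (C (t r)) X) G) -
        X (Sum.inr (Sum.inl r)) * X (Sum.inr (Sum.inr r)))) j with hΦdef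
  have hΦcost : ∀ j, complexity (Φ j) ≤ m * (complexity G + 5) + 1 := by
    intro j
    rcases j with s | s
    · exact complexity_stepPoly_le G t (fun r => (M r).eval (t s)) (Sum.inl s)
    · exact complexity_stepPoly_le G t (fun r => (Nn r).eval (t s)) (Sum.inr s)
  have hvals := eval_iterate_step G P Q hG t M Nn step hstep Φ (fun s => rfl) (fun s => rfl) N
  set v₀ : Fin m ⊕ Fin m → MvPolynomial β F := Sum.elim
    (fun s => C ((P.map (constantCoeff : MvPolynomial β F →+* F)).eval (t s)))
    (fun s => C ((Q.map (constantCoeff : MvPolynomial β F →+* F)).eval (t s))) with hv₀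
  set It := (fun u : Fin m ⊕ Fin m → MvPolynomial (β ⊕ (Fin m ⊕ Fin m)) F => fun j =>
    bind₁ (Sum.elim (X ∘ Sum.inl) Φ) (u j))^[N] (fun j => X (Sum.inr j)) with hIt
  have hus : ∀ s : Fin m, UN.eval (C (t s)) = aeval (Sum.elim X v₀) (It (Sum.inl s)) := by
    intro s
    rw [hIt, aeval_iterate_eq Φ v₀ N (Sum.inl s)]
    have := congrFun hvals (Sum.inl s)
    simp only [Sum.elim_inl] at this
    rw [hUN, hinit, hv₀]
    exact this
  obtain ⟨Lu, hLu⟩ : ∃ Lu : ℕ, Lu = N * ((m + m) * (m * (complexity G + 5) + 1)) := ⟨_, rfl⟩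
  have hucost : ∀ s : Fin m, complexity (UN.eval (C (t s))) ≤ Lu := by
    intro s
    rw [hus s]
    refine (complexity_aeval_le _ _).trans ?_
    have h0 : ∑ i : β ⊕ (Fin m ⊕ Fin m), complexity (Sum.elim X v₀ i) = 0 := by
      refine Finset.sum_eq_zero fun i _ => ?_
      rcases i with x | j
      · exact complexity_X_holds (k := F) x
      · rcases j with s' | s'
        · simp only [hv₀, Sum.elim_inr, Sum.elim_inl]; exact complexity_C_holds _
        · simp only [hv₀, Sum.elim_inr]; exact complexity_C_holds _
    rw [h0, add_zero]
    have := complexity_iterate_le Φ hΦcost N (Sum.inl s)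
    rw [Fintype.card_sum, Fintype.card_fin] at this
    rw [hIt, hLu]
    exact this
  -- Lagrange re-assembly of `U_N = Y^a + T`
  set T := UN - Polynomial.X ^ P.natDegree with hT
  have hTdeg : T.degree < m := by
    have h1 : (P - Polynomial.X ^ P.natDegree).degree < (P.natDegree : WithBot ℕ) :=
      degree_sub_lt_of_monic hP (Polynomial.monic_X_pow _) (Polynomial.natDegree_X_pow _).symm
    have hTeq : T = (P - Polynomial.X ^ P.natDegree) - (P - UN) := by rw [hT]; ring
    have hTa : T.degree < (P.natDegree : WithBot ℕ) := by
      rw [hTeq]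
      exact Polynomial.mem_degreeLT.1 (Submodule.sub_mem _ (Polynomial.mem_degreeLT.2 h1)
        (Polynomial.mem_degreeLT.2 hδdeg))
    exact hTa.trans_le (by exact_mod_cast ham)
  have hTexp := eq_sum_eval_mul_basis t ht T hTdeg
  have hTev : ∀ s, T.eval (C (t s)) = UN.eval (C (t s)) - C (t s ^ P.natDegree) := by
    intro s; rw [hT, Polynomial.eval_sub, Polynomial.eval_pow, Polynomial.eval_X, ← map_pow]
  have hUNexp : (optionEquivLeft F β).symm UN = X none ^ P.natDegree +
      ∑ s : Fin m, rename some (UN.eval (C (t s)) - C (t s ^ P.natDegree)) *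
        (optionEquivLeft F β).symm
          ((Lagrange.basis univ t s).map (C : F →+* MvPolynomial β F)) := by
    have hUT : UN = Polynomial.X ^ P.natDegree +
        ∑ s : Fin m, Polynomial.C (UN.eval (C (t s)) - C (t s ^ P.natDegree)) *
          (Lagrange.basis univ t s).map (C : F →+* MvPolynomial β F) := by
      conv_lhs => rw [show UN = Polynomial.X ^ P.natDegree + T by rw [hT]; ring, hTexp]
      simp only [hTev]
    conv_lhs => rw [hUT]
    rw [map_add, map_pow, optionEquivLeft_symm_X, map_sum]
    refine congrArg _ (sum_congr rfl fun s _ => ?_)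
    rw [map_mul, optionEquivLeft_symm_polynomialC]
  -- cost of `U_N(x, y)`
  have hℓcost : ∀ s : Fin m, complexity ((optionEquivLeft F β).symm
      ((Lagrange.basis univ t s).map (C : F →+* MvPolynomial β F))) ≤ m * (m + 1) := by
    intro s
    refine complexity_symm_map_le _ ?_
    rw [Lagrange.degree_basis (ht.injOn.mono (Set.subset_univ _)) (mem_univ _), card_univ,
      Fintype.card_fin]
    have : 0 < m := Fin.pos s
    exact_mod_cast Nat.sub_lt this Nat.one_pos
  have hUNcost : complexity ((optionEquivLeft F β).symm UN) ≤
      m * (Lu + m * (m + 1) + 2) + 2 * m + 1 := by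
    rw [hUNexp]
    calc _ ≤ complexity (X none ^ P.natDegree : MvPolynomial (Option β) F) +
          complexity (∑ s : Fin m, rename some (UN.eval (C (t s)) - C (t s ^ P.natDegree)) *
            (optionEquivLeft F β).symm
              ((Lagrange.basis univ t s).map (C : F →+* MvPolynomial β F))) + 1 :=
          complexity_add_le_holds _ _
      _ ≤ m + (∑ _s : Fin m, (Lu + m * (m + 1) + 2) + (univ : Finset (Fin m)).card) + 1 := by
          gcongr
          · exact (complexity_X_pow_le _ _).trans ham
          · refine (complexity_finset_sum_le _ _).trans ?_
            gcongr with s _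
            calc _ ≤ complexity (rename some (UN.eval (C (t s)) - C (t s ^ P.natDegree)) :
                    MvPolynomial (Option β) F) +
                  complexity ((optionEquivLeft F β).symm
                    ((Lagrange.basis univ t s).map (C : F →+* MvPolynomial β F))) + 1 :=
                  complexity_mul_le_holds _ _
              _ ≤ (Lu + 1) + m * (m + 1) + 1 := by
                  gcongr
                  · refine (complexity_rename_le_holds' _ _).trans ?_
                    rw [sub_eq_add_neg, ← map_neg C]
                    calc _ ≤ complexity (UN.eval (C (t s))) +
                          complexity (C (-(t s ^ P.natDegree)) : MvPolynomial β F) + 1 :=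
                          complexity_add_le_holds _ _
                      _ ≤ Lu + 0 + 1 := by
                          gcongr
                          · exact hucost s
                          · exact (complexity_C_holds _).le
                      _ = Lu + 1 := by ring
                  · exact hℓcost s
              _ = Lu + m * (m + 1) + 2 := by ring
      _ = m * (Lu + m * (m + 1) + 2) + 2 * m + 1 := by
          rw [sum_const, card_univ, Fintype.card_fin, smul_eq_mul]; ring
  -- final
  rw [heq]
  refine (complexity_sum_homogeneousComponent_le _ N).trans ?_
  have hin : complexity (C a₀ * (optionEquivLeft F β).symm UN) ≤
      m * (2 * N * m * (m * (complexity G + 5) + 1) + m * (m + 1) + 2) + 2 * m + 2 := by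
    calc _ ≤ complexity (C a₀ : MvPolynomial (Option β) F) +
          complexity ((optionEquivLeft F β).symm UN) + 1 := complexity_mul_le_holds _ _
      _ ≤ 0 + (m * (Lu + m * (m + 1) + 2) + 2 * m + 1) + 1 := by
          gcongr
          exact (complexity_C_holds _).le
      _ = m * (2 * N * m * (m * (complexity G + 5) + 1) + m * (m + 1) + 2) + 2 * m + 2 := by
          rw [hLu]; ring
  exact Nat.add_le_add_right (Nat.mul_le_mul_left _ hin) _

end Main

end KaltofenHensel

end Literature.Computability.AlgebraicComplexity

end
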